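import Summits.Langlands.Langlands.Statement
import Literature.NumberTheory.Automorphic.PDAutomorphyLiftingGL2TotallyReal
import HarnessLib

/-!
# Floor witness (F3) for the rung `CyclotomicDihedralLiftingTR = ResidualImageLiftingTR 1`
# (crux `ReciprocityUpToIrreducibility`, item stmt-Langlands-14328; G4 ladder-down, generation 10)

`floor_zero : BLGGT2014_thm421_GL2_totallyReal → ResidualImageLiftingTR 0` — the floor `θ = 0` of the
RESIDUAL-IMAGE dial IS BLGGT Thm 4.2.1 / Dieulefait–Pacetti Thm 8.11 (PD-crystalline automorphy lifting
for `GL₂` over totally real `F`, the tree's named Literature fact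
`Literature/NumberTheory/Automorphic/PDAutomorphyLiftingGL2TotallyReal.lean`), whose binder list the
family copies VERBATIM — the local and residual clauses are packaged as the named Props
`CrystallineRegularAt`, `PotentiallyDiagonalizableAt`, `TaylorWilesHypothesis`, `ResiduallyAbsIrreducible`,
`ResiduallyPDAutomorphic`, each DEFINITIONALLY the fact's clause (the proof passes them by `rfl`-unfolding),
and guarded `θ = 0 →` / `θ ≤ 1 →` / `θ ≤ 2 →` (discharged by `rfl` / `norm_num` at `θ = 0`); the family's
conclusion is the fact's minus the regular-infinity-type clause (projection).  The family is VERBATIM the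
one of `Lines/CyclotomicDihedralLiftingTR.lean`.  Sorry-free; standard axioms; the only non-theorem input
is the named fact, taken as a hypothesis (exactly as g2–g9's `floor_k : named_fact → E k`).
-/

noncomputable section

set_option linter.dupNamespace false

open scoped MatrixGroups Matrix NumberField Classical
open NumberField IsDedekindDomain Field Filter
open Literature.NumberTheory.Automorphic Literature.NumberTheory.GaloisRepresentations
open Literature.NumberTheory.PAdicHodge
open Summit.Langlands

namespace Summit.Langlands.Langlands.Cruxes.ReciprocityUpToIrreducibility.CyclotomicDihedralLiftingTR.Special

/-! ## The sector clauses (verbatim from `BLGGT2014_thm421_GL2_totallyReal`) -/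

/-- `ρ|Γ_{F_v}` is CRYSTALLINE for the PINNED Fontaine datum with two distinct `τ`-labelled Hodge–Tate
weights for every `ℚ_p`-label `τ`, at every `v ∣ p` (the fact's local clause, verbatim). -/
def CrystallineRegularAt {F : Type} [Field F] [NumberField F] (p : ℕ) [Fact p.Prime]
    (ρ : FramedGaloisRep F (PadicAlgCl p) 2) : Prop :=
  ∀ (v : HeightOneSpectrum (𝓞 F)) (hv : ((p : ℕ) : 𝓞 F) ∈ v.asIdeal),
    let D := fontainePstAdicCompletion v p hv
    D.IsCrystallineFramed (ρ.toLocal v) ∧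
    (letI := D.algebra
     ∀ τ : v.adicCompletion F →ₐ[ℚ_[p]] PadicAlgCl p,
      let M := ρ.labelledHodgeTateWeightsAt v D.algebra D.𝔅 τ.toRingHom
      M.Nodup ∧ Multiset.card M = 2)

/-- `ρ|Γ_{F_v}` is POTENTIALLY DIAGONALIZABLE at every `v ∣ p`, relative to every instance of compatible
crystalline extension data over the pinned datum, such instances existing (the fact's clause, verbatim). -/
def PotentiallyDiagonalizableAt {F : Type} [Field F] [NumberField F] (p : ℕ) [Fact p.Prime]
    (ρ : FramedGaloisRep F (PadicAlgCl p) 2) : Prop :=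
  ∀ (v : HeightOneSpectrum (𝓞 F)) (hv : ((p : ℕ) : 𝓞 F) ∈ v.asIdeal),
    Nonempty (PstCrystallineExtensionData (fontainePstAdicCompletion v p hv)) ∧
    ∀ 𝔈 : PstCrystallineExtensionData (fontainePstAdicCompletion v p hv),
      letI := (fontainePstAdicCompletion v p hv).algebra
      IsPotentiallyDiagonalizable 𝔈.𝔅 (ρ.toLocal v)

/-! ## The residual clauses (the dialled hypothesis) -/

/-- **The Taylor–Wiles hypothesis** (residual depth `0`): `ρ̄|Γ_{F(ζ_p)}` is absolutely irreducible —
trace rendering: `tr ρ̄|Γ_{F(ζ_p)}` is not the sum of two finite-order characters (the fact's `hbig`). -/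
def TaylorWilesHypothesis (F : Type) [Field F] [NumberField F] (p : ℕ) [Fact p.Prime]
    (ρ : FramedGaloisRep F (PadicAlgCl p) 2) : Prop :=
  ¬ ∃ χ₁ χ₂ : absoluteGaloisGroup (CyclotomicField p F) →* (PadicAlgCl p)ˣ,
      IsOpen (χ₁.ker : Set (absoluteGaloisGroup (CyclotomicField p F))) ∧
      IsOpen (χ₂.ker : Set (absoluteGaloisGroup (CyclotomicField p F))) ∧
      ∀ σ, ‖(ρ.restrictField (CyclotomicField p F) σ).val.trace -
        ((χ₁ σ : PadicAlgCl p) + (χ₂ σ : PadicAlgCl p))‖ < 1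

/-- **`ρ̄` absolutely irreducible over `F`** (residual depth `≤ 1`): `tr ρ̄` is not the sum of two
finite-order characters of `Γ_F` (same rendering, over `F` instead of `F(ζ_p)`).  Given this, the
Taylor–Wiles hypothesis fails exactly when `ρ̄ ≅ Ind_{Γ_K}^{Γ_F} χ̄` for the quadratic subfield
`K ⊂ F(ζ_p)` — the CYCLOTOMIC-DIHEDRAL residual images. [cite: Thorne2016, §1] -/
def ResiduallyAbsIrreducible (F : Type) [Field F] [NumberField F] (p : ℕ) [Fact p.Prime]
    (ρ : FramedGaloisRep F (PadicAlgCl p) 2) : Prop :=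
  ¬ ∃ χ₁ χ₂ : absoluteGaloisGroup F →* (PadicAlgCl p)ˣ,
      IsOpen (χ₁.ker : Set (absoluteGaloisGroup F)) ∧
      IsOpen (χ₂.ker : Set (absoluteGaloisGroup F)) ∧
      ∀ σ, ‖(ρ σ).val.trace - ((χ₁ σ : PadicAlgCl p) + (χ₂ σ : PadicAlgCl p))‖ < 1

/-- **Residually PD-automorphic of level prime to `p`** (residual depth `≤ 2`, demanded only of
absolutely irreducible `ρ̄`): the fact's witness clause verbatim — a cuspidal `π₀`, L-algebraic with a
regular infinity type, unramified above `p`, attached a.e. to some `ρ₀ ≡ ρ (mod 𝔪)` (traces) that is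
potentially diagonalizable above `p`. -/
def ResiduallyPDAutomorphic (F : Type) [Field F] [NumberField F] (p : ℕ) [Fact p.Prime]
    (hcpt : isCompact_glFiniteIntegralLevel 2 F) (ι : PadicAlgCl p ≃+* ℂ)
    (ρ : FramedGaloisRep F (PadicAlgCl p) 2) : Prop :=
  ∃ (π₀ : CuspidalAutomorphicRepData 2 F hcpt) (ρ₀ : FramedGaloisRep F (PadicAlgCl p) 2),
    π₀.1.IsLAlgebraic ∧ (∃ T : InfinityType F 2, π₀.1.HasInfinityType T ∧ T.IsRegular) ∧
    SatakeFrobCompatibleAE ι π₀.1 ρ₀ ∧ (∀ σ, ‖(ρ σ).val.trace - (ρ₀ σ).val.trace‖ < 1) ∧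
    (∀ v : HeightOneSpectrum (𝓞 F), ((p : ℕ) : 𝓞 F) ∈ v.asIdeal → π₀.1.IsUnramifiedAt v) ∧
    ∀ (v : HeightOneSpectrum (𝓞 F)) (hv : ((p : ℕ) : 𝓞 F) ∈ v.asIdeal)
      (𝔈 : PstCrystallineExtensionData (fontainePstAdicCompletion v p hv)),
      letI := (fontainePstAdicCompletion v p hv).algebra
      IsPotentiallyDiagonalizable 𝔈.𝔅 (ρ₀.toLocal v)

/-! ## The family and the rung -/

/-- **The rung family** `E(θ)` — residual-image depth `θ` in PD-crystalline automorphy lifting for `GL₂`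
over totally real `F` (`p ≥ 7`, `p ∤ d_F`; `ρ : Γ_F → GL₂(ℚ̄_p)` irreducible, a.e. unramified, totally
odd, `CrystallineRegularAt`, `PotentiallyDiagonalizableAt`), residual clauses `θ = 0 →` Taylor–Wiles
hypothesis, `θ ≤ 1 →` `ρ̄` absolutely irreducible, `θ ≤ 2 →` (absolutely irreducible `ρ̄` is residually
PD-automorphic); conclusion: `ρ` is automorphic — an L-algebraic cuspidal `π` of `GL₂(𝔸_F)` with
`SatakeFrobCompatibleAE ι π ρ`.  `θ = 0`: BLGGT 4.2.1 / Dieulefait–Pacetti 8.11 (the tree's named fact: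
FLOOR); `θ = 1`: THE RUNG (print: weight `{0,1}` — Thorne 2016 Thm 1.2, Kalyanswamy 2018 Thm 1.1;
ordinary — Skinner–Wiles 2001; `F = ℚ` — Pan 2022 / Zhang 2025; OPEN otherwise); `θ = 2`: + residually
reducible (OPEN off `F = ℚ` / ordinary-abelian); `θ ≥ 3`: + Serre's conjecture over `F` (OPEN).
[cite: BarnetlambEtAl2014, Thm. 4.2.1] [cite: DieulefaitPacetti2015, Thm. 8.11] [cite: Thorne2016, Thm. 1.2] -/
def ResidualImageLiftingTR (θ : ℕ) : Prop :=
  ∀ (F : Type) [Field F] [NumberField F], IsTotallyReal F → ∀ (p : ℕ) [Fact p.Prime], 7 ≤ p →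
    ¬ ((p : ℤ) ∣ NumberField.discr F) →
    ∀ (hcpt : isCompact_glFiniteIntegralLevel 2 F) (ι : PadicAlgCl p ≃+* ℂ)
      (ρ : FramedGaloisRep F (PadicAlgCl p) 2),
      ρ.toGaloisRep.IsIrreducible →
      (∀ᶠ v : HeightOneSpectrum (𝓞 F) in cofinite, ρ.IsUnramifiedAt v) →
      ρ.IsOdd →
      CrystallineRegularAt p ρ →
      PotentiallyDiagonalizableAt p ρ →
      (θ = 0 → TaylorWilesHypothesis F p ρ) →
      (θ ≤ 1 → ResiduallyAbsIrreducible F p ρ) →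
      (θ ≤ 2 → ResiduallyAbsIrreducible F p ρ → ResiduallyPDAutomorphic F p hcpt ι ρ) →
      ∃ π : CuspidalAutomorphicRepData 2 F hcpt, π.1.IsLAlgebraic ∧ SatakeFrobCompatibleAE ι π.1 ρ

/-- **THE RUNG** (the filed statement): the family at `θ = 1` — PD-crystalline automorphy lifting for
`GL₂` over totally real fields WITHOUT the Taylor–Wiles hypothesis (`ρ̄` absolutely irreducible over `F`,
`ρ̄|Γ_{F(ζ_p)}` arbitrary: the cyclotomic-dihedral residual images admitted). -/
def CyclotomicDihedralLiftingTR : Prop := ResidualImageLiftingTR 1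

/-! ## Floor: `θ = 0` is the named fact -/

/-- **FLOOR** `θ = 0` from the named fact BLGGT Thm 4.2.1 / Dieulefait–Pacetti Thm 8.11 (the clauses are
the fact's by `rfl`; projection: forget the regular infinity type of `π`). -/
theorem floor_zero (h : BLGGT2014_thm421_GL2_totallyReal) : ResidualImageLiftingTR 0 := by
  intro F _ _ hF p _ hp hdisc hcpt ι ρ hirr hunr hodd hcrys hpd hbig hirrF hmod
  obtain ⟨π, hL, -, hS⟩ := h F hF p hp hdisc hcpt ι ρ hirr hunr hodd hcrys hpd (hbig rfl)
    (hmod (by norm_num) (hirrF (by norm_num)))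
  exact ⟨π, hL, hS⟩

/-- F3 instantiation check: the floor IS the family at the dial value `θ := 0`. -/
example (h : BLGGT2014_thm421_GL2_totallyReal) : ResidualImageLiftingTR 0 := by
  simpa using floor_zero h

end Summit.Langlands.Langlands.Cruxes.ReciprocityUpToIrreducibility.CyclotomicDihedralLiftingTR.Special

end
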